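import Summits.QuantumFields.YangMills.Theorems.LuscherReductionTwistedTraceScalingBODefectCoreSq
import HarnessLib

/-!
# (A3) THE (C4)-CORE `L²` ESTIMATE IN MOMENT FORM: the weighted `L²` size of the quasimode defect on the inner core from a SQUARED pointwise core estimate
# `(K(oT u' v') − Z⁻¹a₀e^{−q(x')}P(u'))² ≤ Z⁻²a₀e^{−q(x')}·Φ(u',v')` with an ARBITRARY nonnegative slow×fibre majorant `Φ` — the moment twin of lane A's
# `…BODefectCoreSq.defect_core_sq_integral_le`, whose constant `ε` is replaced by `Φ`
# (memo `Cruxes/NearFlatRatioLaw/Lines/ratepack-v7-moments-g18.md` §5 (A2)–(A3); route `FlatTubeReduction`, crux K1 `NearFlatRatioLaw` stmt-QuantumFields-24720, line «ratepack_v2» skeleton v6,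
# stub `stub_hODpot_A`; seat `ym-line-ftr-p1` g18; R2b1 RECORD rung — no summit statement is proved here)

WHY.  For the rate `O(λ_b)` of `stub_hODpot_A` the pointwise core quasimode estimate is available only in SQUARED, moment form
(`…CoreTransferMomentsCS.colour_fpFibreTransfer_defect_sq_le_moments` + `…SlowCauchySchwarz.sq_slow_defect_le`): at the tube point `oT u' v'`,
`(K − Z⁻¹a₀e^{−q(x')}P(u'))² ≤ Z⁻²·a₀e^{−q(x')}·Φ(u',v')` with `Φ(u',v') = (∫φ²ρ̄)(u')·(A·c_q·∫_uD + E·c_q²a₀'e^{−q(x')}‖ρ̄‖₁)`.  The dual-profile algebra of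
`defect_core_pointwise` goes through with squares: `(K/w − ψge)²w ≤ (2(K − m)² + 2(mκ/… )²)·g/N`, and the tube disintegration integrates the majorant:
* `defect_core_pointwise_sq` — `(K/w − ψ(ge))²·w ≤ (2Z⁻²a₀e·Φ + 2(Z⁻¹a₀eκP_a)²)·g/(N̄(1−κ))`;
* ★★★ `defect_core_sq_integral_le_moment` — `∫ 𝟙_{S_in}(K/w − ψ⊗Ω_c)²w ≤ (2Z⁻²a₀/(N̄(1−κ)))·∫_v 𝟙_{‖x‖≤R_in}e^{−q}e^{−‖P_Γx‖²/(powScale 1 β)²}·(∫_{u∈W_out}Φ(u,v)du) dπ(v)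
  + (2(Z⁻¹a₀κ)²/(N̄(1−κ)))·(∫ 𝟙_{‖x‖≤R_in}e^{−2q}e^{−‖P_Γx‖²/(powScale 1 β)²} dπ)·∫P_a²`.
The fibre factor of the first term is where `…TwoProfileKernel` / `…CentralColourRemoval` / the reference-moment machine enter (memo §5 (A4)).
HONEST FRAMING: bookkeeping for a stub of the CONDITIONAL reduction route R2b1 (rate twin); the instantiation with the record data, (A4-c), (C1)-rate, the `hdef` wrapper, (B-ST) and the
crux remain OPEN; femto rung R2b1 (RECORD label); not infinite volume, not a mass gap, not Clay.  No defs, no named facts, no `sorry`.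
-/

set_option autoImplicit false

noncomputable section

open MeasureTheory Filter Topology Real
open scoped BigOperators
open Literature.MathematicalPhysics.QuantumFieldTheory
open Literature.MathematicalPhysics.QuantumLattice

namespace Summit.QuantumFields.YangMills.Theorems.FemtoTransferGap.TwoLattice.ConstTube

open Summit.QuantumFields.YangMills.Theorems.FemtoTransferGap
open Summit.QuantumFields.YangMills.Theorems.FemtoTransferGap.TwoLattice
open Summit.QuantumFields.YangMills.Theorems.FemtoTransferGap.TwoLattice.Avg
open Summit.QuantumFields.YangMills.Theorems.FemtoTransferGap.TwoLattice.Stiff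
open Summit.QuantumFields.YangMills.Theorems.FemtoTransferGap.TwoLattice.GnChart

variable {L : ℕ} [NeZero L]

/-! ## §1 The real-number heart, squared form -/

/-- **Pointwise, squared form.**  Reals `K`, `N ∈ [N̄(1−κ), N̄(1+κ)]` with `N̄(1−κ) > 0`, `κ ≥ 0`, `g > 0`, `e ≥ 0`, `Z⁻¹, a₀ ≥ 0`, `|P| ≤ P_a`, `Φ ≥ 0` and the squared quasimode estimate
`(K − Z⁻¹(a₀e)P)² ≤ Z⁻²·(a₀e)·Φ`.  Then with `w = N/g` and `ψ = Z⁻¹a₀P/N̄`: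
`(K/w − ψ·(g·e))²·w ≤ (2Z⁻²(a₀e)Φ + 2(Z⁻¹(a₀e)κP_a)²)·g/(N̄(1−κ))`. [folklore] -/
theorem defect_core_pointwise_sq {K N Nbar κ g e Zi a₀ P Pa Φ : ℝ} (hN : Nbar * (1 - κ) ≤ N ∧ N ≤ Nbar * (1 + κ)) (hNκ : 0 < Nbar * (1 - κ)) (hκ : 0 ≤ κ)
    (hg : 0 < g) (he : 0 ≤ e) (hZi : 0 ≤ Zi) (ha₀ : 0 ≤ a₀) (hP : |P| ≤ Pa) (hΦ : 0 ≤ Φ)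
    (hdef : (K - Zi * (a₀ * e) * P) ^ 2 ≤ Zi ^ 2 * (a₀ * e) * Φ) :
    (K / (N / g) - Zi * a₀ / Nbar * P * (g * e)) ^ 2 * (N / g) ≤ (2 * (Zi ^ 2 * (a₀ * e) * Φ) + 2 * (Zi * (a₀ * e) * κ * Pa) ^ 2) * (g / (Nbar * (1 - κ))) := by
  have hNbar : 0 < Nbar := by
    rcases lt_or_ge 0 Nbar with h | h
    · exact h
    · nlinarith
  have hNpos : 0 < N := lt_of_lt_of_le hNκ hN.1
  have hPa : 0 ≤ Pa := (abs_nonneg _).trans hP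
  have hA : 0 ≤ Zi * (a₀ * e) := mul_nonneg hZi (mul_nonneg ha₀ he)
  have hratio : |N / Nbar - 1| ≤ κ := by
    rw [abs_le]
    constructor
    · rw [le_sub_iff_add_le, le_div_iff₀ hNbar]; linarith [hN.1]
    · rw [sub_le_iff_le_add, div_le_iff₀ hNbar]; linarith [hN.2]
  -- the mismatch term
  have h2 : |Zi * (a₀ * e) * P - Zi * (a₀ * e) * P * (N / Nbar)| ≤ Zi * (a₀ * e) * Pa * κ := by
    have e2 : Zi * (a₀ * e) * P - Zi * (a₀ * e) * P * (N / Nbar) = -(Zi * (a₀ * e) * P * (N / Nbar - 1)) := by ring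
    rw [e2, abs_neg, abs_mul, abs_mul, abs_of_nonneg hA]
    exact mul_le_mul (mul_le_mul_of_nonneg_left hP hA) hratio (abs_nonneg _) (mul_nonneg hA hPa)
  -- the total defect squared: `(K − ψ e N)² ≤ 2(K − m)² + 2(mismatch)²`
  have e1 : Zi * a₀ / Nbar * P * (g * e) * (N / g) = Zi * (a₀ * e) * P * (N / Nbar) := by field_simp
  have hkey : (K - Zi * a₀ / Nbar * P * (g * e) * (N / g)) ^ 2 ≤ 2 * (Zi ^ 2 * (a₀ * e) * Φ) + 2 * (Zi * (a₀ * e) * κ * Pa) ^ 2 := by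
    rw [e1]
    have esplit : K - Zi * (a₀ * e) * P * (N / Nbar) = (K - Zi * (a₀ * e) * P) + (Zi * (a₀ * e) * P - Zi * (a₀ * e) * P * (N / Nbar)) := by ring
    rw [esplit]
    have hm2 : (Zi * (a₀ * e) * P - Zi * (a₀ * e) * P * (N / Nbar)) ^ 2 ≤ (Zi * (a₀ * e) * κ * Pa) ^ 2 := by
      rw [← sq_abs (Zi * (a₀ * e) * P - Zi * (a₀ * e) * P * (N / Nbar))]
      have h0 : 0 ≤ Zi * (a₀ * e) * κ * Pa := by positivity
      have h2' : |Zi * (a₀ * e) * P - Zi * (a₀ * e) * P * (N / Nbar)| ≤ Zi * (a₀ * e) * κ * Pa := by linarith [h2]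
      exact pow_le_pow_left₀ (abs_nonneg _) h2' 2
    nlinarith [sq_nonneg ((K - Zi * (a₀ * e) * P) - (Zi * (a₀ * e) * P - Zi * (a₀ * e) * P * (N / Nbar))), hdef, hm2]
  -- `(K/w − ψge)²w = (K − ψgeN/g)²·(g/N) ≤ (…)·g/(N̄(1−κ))`
  have hw : 0 < N / g := div_pos hNpos hg
  have e3 : (K / (N / g) - Zi * a₀ / Nbar * P * (g * e)) ^ 2 * (N / g) = (K - Zi * a₀ / Nbar * P * (g * e) * (N / g)) ^ 2 * (g / N) := by
    field_simp
  rw [e3]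
  have hgN : g / N ≤ g / (Nbar * (1 - κ)) := div_le_div_of_nonneg_left hg.le hNκ hN.1
  have hB0 : 0 ≤ 2 * (Zi ^ 2 * (a₀ * e) * Φ) + 2 * (Zi * (a₀ * e) * κ * Pa) ^ 2 := by positivity
  exact mul_le_mul hkey hgN (div_nonneg hg.le hNpos.le) hB0

/-! ## §2 ★★★ Integration over the inner core region -/

/-- ★★★ **THE (C4)-CORE `L²` ESTIMATE IN MOMENT FORM** (hypotheses as in `…BODefectCoreSq.defect_core_sq_integral_le`, with the pointwise estimate replaced by the SQUARED estimate against a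
jointly measurable bounded `Φ ≥ 0`):
`∫ 𝟙_{S_in}·(K/w − boFun ψ Ω_c)²·w ≤ (2Z⁻²a₀/(N̄(1−κ)))·∫ 𝟙_{‖x_v‖≤R_in}e^{−q(x_v)}e^{−‖P_Γx_v‖²/(powScale 1 β)²}·(∫ 𝟙_{W_out}(u)Φ(u,v) du) dπ(v)
+ (2(Z⁻¹a₀κ)²/(N̄(1−κ)))·(∫ 𝟙_{‖x‖≤R_in}e^{−2q}e^{−‖P_Γx‖²/(powScale 1 β)²} dπ)·∫P_a²`. [cite: Luscher1983, §3] [cite: SjostrandZworski2007, §2] -/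
theorem defect_core_sq_integral_le_moment (β : ℝ) {F : Set (GaugeConfig 3 L SU2)} (hF : MeasurableSet F) {χ : GaugeConfig 3 L SU2 → ℝ}
    (hχ : ∀ U, χ U = F.indicator (fun _ => (1 : ℝ)) U * Real.exp (-(gaugeCoordSq L U / powScale 1 β ^ 2)))
    {Nbar κ : ℝ} (hNκ : 0 < Nbar * (1 - κ)) (hκ : 0 ≤ κ)
    (hP : ∀ U ∈ F, Nbar * (1 - κ) ≤ gaugeAvg χ U ∧ gaugeAvg χ U ≤ Nbar * (1 + κ))
    {q : ℝ → LinkSpace L → ℝ} (hqm : ∀ β', Measurable (q β')) (hq0 : ∀ x, 0 ≤ q β x) (r : ℝ → ℝ)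
    {K : GaugeConfig 3 L SU2 → ℝ} (hKm : Measurable K)
    {P Pa : GaugeConfig 3 1 SU2 → ℝ} (hPm : Measurable P) (hPam : Measurable Pa) {CP : ℝ} (hCP : ∀ u, |Pa u| ≤ CP) (hPPa : ∀ u, |P u| ≤ Pa u)
    {Φ : GaugeConfig 3 1 SU2 → (Edge 3 L → Fin 3 → ℝ) → ℝ} (hΦm : Measurable (Function.uncurry Φ)) (hΦ0 : ∀ u v, 0 ≤ Φ u v) {CΦ : ℝ} (hCΦ : ∀ u v, Φ u v ≤ CΦ)
    {Zi a₀ Rin : ℝ} (hZi : 0 ≤ Zi) (ha₀ : 0 ≤ a₀) (hRin : Rin ≤ r β)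
    {Wout : Set (GaugeConfig 3 1 SU2)} (hWout : MeasurableSet Wout)
    (hdef : ∀ u' ∈ Wout, ∀ v' ∈ capBalancedSet L, ‖linkEmbed L v'‖ ≤ Rin → orthoTube L u' v' ∈ F →
      (K (orthoTube L u' v') - Zi * (a₀ * Real.exp (-(q β (linkEmbed L v')))) * P u') ^ 2 ≤ Zi ^ 2 * (a₀ * Real.exp (-(q β (linkEmbed L v')))) * Φ u' v') :
    ∫ U, {U : GaugeConfig 3 L SU2 | U ∈ orthoTubeSet L ∧ χ U ≠ 0 ∧ ‖relLinkVec L U‖ ≤ Rin ∧ slowMean L U ∈ Wout}.indicator (fun _ => (1 : ℝ)) U *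
        ((K U / softWeight χ U -
            boFun L (fun u' => Zi * a₀ / Nbar * P u')
              (fun x : LinkSpace L => {x : LinkSpace L | linkCurry x ∈ capBalancedSet L}.indicator (fun _ => (1 : ℝ)) x * frozenProfile L q r β x) U) ^ 2 *
          softWeight χ U) ∂configMeasure SU2 L ≤
      2 * (Zi ^ 2 * a₀) / (Nbar * (1 - κ)) *
          ∫ v, {v : Edge 3 L → Fin 3 → ℝ | ‖linkEmbed L v‖ ≤ Rin}.indicator (fun _ => (1 : ℝ)) v *
              (Real.exp (-(q β (linkEmbed L v))) * Real.exp (-(‖(gaugeModes L).starProjection (linkEmbed L v)‖ ^ 2 / powScale 1 β ^ 2))) *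
            ∫ u, Wout.indicator (fun _ => (1 : ℝ)) u * Φ u v ∂configMeasure SU2 1 ∂orthoTransverse L +
        2 * (Zi * a₀ * κ) ^ 2 / (Nbar * (1 - κ)) *
          (∫ v, {v : Edge 3 L → Fin 3 → ℝ | ‖linkEmbed L v‖ ≤ Rin}.indicator (fun _ => (1 : ℝ)) v *
              (Real.exp (-(q β (linkEmbed L v))) ^ 2 * Real.exp (-(‖(gaugeModes L).starProjection (linkEmbed L v)‖ ^ 2 / powScale 1 β ^ 2))) ∂orthoTransverse L) *
          ∫ u, Pa u ^ 2 ∂configMeasure SU2 1 := by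
  haveI := isFiniteMeasure_orthoTransverse L
  set Sin : Set (GaugeConfig 3 L SU2) := {U : GaugeConfig 3 L SU2 | U ∈ orthoTubeSet L ∧ χ U ≠ 0 ∧ ‖relLinkVec L U‖ ≤ Rin ∧ slowMean L U ∈ Wout} with hSin
  set Ωc : LinkSpace L → ℝ := fun x => {x : LinkSpace L | linkCurry x ∈ capBalancedSet L}.indicator (fun _ => (1 : ℝ)) x * frozenProfile L q r β x with hΩc
  set ψ : GaugeConfig 3 1 SU2 → ℝ := fun u' => Zi * a₀ / Nbar * P u' with hψ
  set C1 : ℝ := 2 * (Zi ^ 2 * a₀) / (Nbar * (1 - κ)) with hC1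
  set C2 : ℝ := 2 * (Zi * a₀ * κ) ^ 2 / (Nbar * (1 - κ)) with hC2
  set gf1 : (Edge 3 L → Fin 3 → ℝ) → ℝ := fun v => {v : Edge 3 L → Fin 3 → ℝ | ‖linkEmbed L v‖ ≤ Rin}.indicator (fun _ => (1 : ℝ)) v *
    (Real.exp (-(q β (linkEmbed L v))) * Real.exp (-(‖(gaugeModes L).starProjection (linkEmbed L v)‖ ^ 2 / powScale 1 β ^ 2))) with hgf1
  set gf : (Edge 3 L → Fin 3 → ℝ) → ℝ := fun v => {v : Edge 3 L → Fin 3 → ℝ | ‖linkEmbed L v‖ ≤ Rin}.indicator (fun _ => (1 : ℝ)) v *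
    (Real.exp (-(q β (linkEmbed L v))) ^ 2 * Real.exp (-(‖(gaugeModes L).starProjection (linkEmbed L v)‖ ^ 2 / powScale 1 β ^ 2))) with hgf
  set SΦ : (Edge 3 L → Fin 3 → ℝ) → GaugeConfig 3 1 SU2 → ℝ := fun v u => Wout.indicator (fun _ => (1 : ℝ)) u * Φ u v with hSΦ
  set G : GaugeConfig 3 L SU2 → ℝ := fun U => Sin.indicator (fun _ => (1 : ℝ)) U * ((K U / softWeight χ U - boFun L ψ Ωc U) ^ 2 * softWeight χ U) with hG
  have hC1nn : 0 ≤ C1 := by rw [hC1]; exact div_nonneg (by positivity) hNκ.le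
  have hC2nn : 0 ≤ C2 := by rw [hC2]; exact div_nonneg (by positivity) hNκ.le
  have hCP0 : 0 ≤ CP := (abs_nonneg _).trans (hCP 1)
  have hCΦ0 : 0 ≤ CΦ := (hΦ0 1 0).trans (hCΦ 1 0)
  -- basic facts about `χ`, `N`, `w`
  have hχm : Measurable χ := by
    have : χ = fun U => F.indicator (fun _ => (1 : ℝ)) U * Real.exp (-(gaugeCoordSq L U / powScale 1 β ^ 2)) := funext hχ
    rw [this]
    exact (measurable_const.indicator hF).mul (((measurable_gaugeCoordSq L).div_const _).neg).exp
  have hχF : ∀ U, χ U ≠ 0 → U ∈ F := fun U hU => by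
    by_contra h; apply hU; rw [hχ, Set.indicator_of_notMem h, zero_mul]
  have hχ01 : ∀ U, 0 ≤ χ U ∧ χ U ≤ 1 := fun U => by
    rw [hχ]
    by_cases h : U ∈ F
    · rw [Set.indicator_of_mem h, one_mul]
      exact ⟨(Real.exp_pos _).le, Real.exp_le_one_iff.mpr (neg_nonpos.mpr (div_nonneg (gaugeCoordSq_nonneg L U) (sq_nonneg _)))⟩
    · rw [Set.indicator_of_notMem h, zero_mul]; exact ⟨le_rfl, zero_le_one⟩
  have hN0 : ∀ U, 0 ≤ gaugeAvg χ U := fun U => (gaugeAvg_mem_Icc hχm (fun V => (hχ01 V).1) (fun V => (hχ01 V).2) U).1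
  have hw0 : ∀ U, 0 ≤ softWeight χ U := fun U => div_nonneg (hN0 U) (hχ01 U).1
  have hG0 : ∀ U, 0 ≤ G U := fun U => by
    rw [hG]; dsimp only
    by_cases h : U ∈ Sin
    · rw [Set.indicator_of_mem h, one_mul]; exact mul_nonneg (sq_nonneg _) (hw0 U)
    · rw [Set.indicator_of_notMem h, zero_mul]
  have hgf1_0 : ∀ v, 0 ≤ gf1 v := fun v => by
    rw [hgf1]; dsimp only
    by_cases h : v ∈ {v : Edge 3 L → Fin 3 → ℝ | ‖linkEmbed L v‖ ≤ Rin}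
    · rw [Set.indicator_of_mem h]; positivity
    · rw [Set.indicator_of_notMem h, zero_mul]
  have hgf0 : ∀ v, 0 ≤ gf v := fun v => by
    rw [hgf]; dsimp only
    by_cases h : v ∈ {v : Edge 3 L → Fin 3 → ℝ | ‖linkEmbed L v‖ ≤ Rin}
    · rw [Set.indicator_of_mem h]; positivity
    · rw [Set.indicator_of_notMem h, zero_mul]
  have hgf1_1 : ∀ v, gf1 v ≤ 1 := fun v => by
    rw [hgf1]; dsimp only
    by_cases h : v ∈ {v : Edge 3 L → Fin 3 → ℝ | ‖linkEmbed L v‖ ≤ Rin}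
    · rw [Set.indicator_of_mem h, one_mul]
      have h1 : Real.exp (-(q β (linkEmbed L v))) ≤ 1 := Real.exp_le_one_iff.mpr (neg_nonpos.mpr (hq0 _))
      have h2 : Real.exp (-(‖(gaugeModes L).starProjection (linkEmbed L v)‖ ^ 2 / powScale 1 β ^ 2)) ≤ 1 := Real.exp_le_one_iff.mpr (neg_nonpos.mpr (by positivity))
      calc _ ≤ 1 * 1 := mul_le_mul h1 h2 (Real.exp_pos _).le zero_le_one
        _ = 1 := one_mul _
    · rw [Set.indicator_of_notMem h, zero_mul]; exact zero_le_one
  have hgf_1 : ∀ v, gf v ≤ 1 := fun v => by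
    rw [hgf]; dsimp only
    by_cases h : v ∈ {v : Edge 3 L → Fin 3 → ℝ | ‖linkEmbed L v‖ ≤ Rin}
    · rw [Set.indicator_of_mem h, one_mul]
      have h1 : Real.exp (-(q β (linkEmbed L v))) ^ 2 ≤ 1 := pow_le_one₀ (Real.exp_pos _).le (Real.exp_le_one_iff.mpr (neg_nonpos.mpr (hq0 _)))
      have h2 : Real.exp (-(‖(gaugeModes L).starProjection (linkEmbed L v)‖ ^ 2 / powScale 1 β ^ 2)) ≤ 1 := Real.exp_le_one_iff.mpr (neg_nonpos.mpr (by positivity))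
      calc _ ≤ 1 * 1 := mul_le_mul h1 h2 (Real.exp_pos _).le zero_le_one
        _ = 1 := one_mul _
    · rw [Set.indicator_of_notMem h, zero_mul]; exact zero_le_one
  have hSΦ0 : ∀ v u, 0 ≤ SΦ v u := fun v u => by
    rw [hSΦ]; dsimp only
    by_cases h : u ∈ Wout
    · rw [Set.indicator_of_mem h, one_mul]; exact hΦ0 u v
    · rw [Set.indicator_of_notMem h, zero_mul]
  have hSΦb : ∀ v u, SΦ v u ≤ CΦ := fun v u => by
    rw [hSΦ]; dsimp only
    by_cases h : u ∈ Wout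
    · rw [Set.indicator_of_mem h, one_mul]; exact hCΦ u v
    · rw [Set.indicator_of_notMem h, zero_mul]; exact hCΦ0
  -- ★ the pointwise bound along the tube
  have hpt : ∀ (u : GaugeConfig 3 1 SU2) (v : Edge 3 L → Fin 3 → ℝ), v ∈ capBalancedSet L →
      G (orthoTube L u v) ≤ C1 * gf1 v * SΦ v u + C2 * gf v * Pa u ^ 2 := by
    intro u v hv
    by_cases hS : orthoTube L u v ∈ Sin
    · obtain ⟨-, hχU, hRU, hWU⟩ := hS
      rw [relLinkVec_orthoTube L u hv] at hRU
      rw [slowMean_orthoTube L u hv] at hWU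
      have hUF : orthoTube L u v ∈ F := hχF _ hχU
      have hd := hdef u hWU v hv hRU hUF
      have hχU' : χ (orthoTube L u v) = Real.exp (-(‖(gaugeModes L).starProjection (linkEmbed L v)‖ ^ 2 / powScale 1 β ^ 2)) := by
        rw [hχ, Set.indicator_of_mem hUF, one_mul, gaugeCoordSq_orthoTube u hv]
      have hg : 0 < Real.exp (-(‖(gaugeModes L).starProjection (linkEmbed L v)‖ ^ 2 / powScale 1 β ^ 2)) := Real.exp_pos _
      have hwU : softWeight χ (orthoTube L u v) = gaugeAvg χ (orthoTube L u v) / Real.exp (-(‖(gaugeModes L).starProjection (linkEmbed L v)‖ ^ 2 / powScale 1 β ^ 2)) := by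
        rw [softWeight_eq_div, hχU']
      have hball : linkEmbed L v ∈ Metric.closedBall (0 : LinkSpace L) (r β) := by
        rw [Metric.mem_closedBall, dist_zero_right]; exact hRU.trans hRin
      have hΩv : Ωc (linkEmbed L v) = Real.exp (-(‖(gaugeModes L).starProjection (linkEmbed L v)‖ ^ 2 / powScale 1 β ^ 2)) * Real.exp (-(q β (linkEmbed L v))) := by
        rw [hΩc]; dsimp only
        rw [Set.indicator_of_mem ((linkEmbed_mem_capLink_iff (L := L) v).2 hv), one_mul]
        unfold frozenProfile
        rw [Set.indicator_of_mem hball, mul_one]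
      have hbo : boFun L ψ Ωc (orthoTube L u v) = Zi * a₀ / Nbar * P u * (Real.exp (-(‖(gaugeModes L).starProjection (linkEmbed L v)‖ ^ 2 / powScale 1 β ^ 2)) * Real.exp (-(q β (linkEmbed L v)))) := by
        rw [boFun_orthoTube L ψ Ωc u hv, hΩv]
      have hmem : v ∈ {v : Edge 3 L → Fin 3 → ℝ | ‖linkEmbed L v‖ ≤ Rin} := hRU
      have hgf1v : gf1 v = Real.exp (-(q β (linkEmbed L v))) * Real.exp (-(‖(gaugeModes L).starProjection (linkEmbed L v)‖ ^ 2 / powScale 1 β ^ 2)) := by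
        rw [hgf1]; dsimp only; rw [Set.indicator_of_mem hmem, one_mul]
      have hgfv : gf v = Real.exp (-(q β (linkEmbed L v))) ^ 2 * Real.exp (-(‖(gaugeModes L).starProjection (linkEmbed L v)‖ ^ 2 / powScale 1 β ^ 2)) := by
        rw [hgf]; dsimp only; rw [Set.indicator_of_mem hmem, one_mul]
      have hSΦv : SΦ v u = Φ u v := by rw [hSΦ]; dsimp only; rw [Set.indicator_of_mem hWU, one_mul]
      rw [hG]; dsimp only
      rw [Set.indicator_of_mem (show orthoTube L u v ∈ Sin from ⟨orthoTube_mem L u hv, hχU, by rwa [relLinkVec_orthoTube L u hv], by rwa [slowMean_orthoTube L u hv]⟩),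
        one_mul, hwU, hbo, hgf1v, hgfv, hSΦv]
      have hreal := defect_core_pointwise_sq (hP _ hUF) hNκ hκ hg (Real.exp_pos _).le hZi ha₀ (hPPa u) (hΦ0 u v) hd
      refine hreal.trans (le_of_eq ?_)
      rw [hC1, hC2]
      field_simp
    · rw [hG]; dsimp only
      rw [Set.indicator_of_notMem hS, zero_mul]
      exact add_nonneg (mul_nonneg (mul_nonneg hC1nn (hgf1_0 v)) (hSΦ0 v u)) (mul_nonneg (mul_nonneg hC2nn (hgf0 v)) (sq_nonneg _))
  -- measurability and boundedness of `G`
  have hψm : Measurable ψ := hPm.const_mul _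
  have hΩcm : Measurable Ωc := measurable_capRestrict (L := L) (measurable_frozenProfile (q := q) hqm r β)
  have hwm : Measurable (softWeight χ) := (measurable_gaugeAvg hχm).div hχm
  have hSm : MeasurableSet Sin := by
    rw [hSin]
    refine (measurableSet_orthoTubeSet L).inter ((hχm (measurableSet_singleton 0).compl).inter
      ((measurableSet_le (measurable_relLinkVec L).norm measurable_const).inter ?_))
    exact hWout.preimage (measurable_slowMean L)
  have hGm : Measurable G := by
    rw [hG]
    exact (measurable_const.indicator hSm).mul ((((hKm.div hwm).sub (measurable_boFun L hψm hΩcm)).pow_const 2).mul hwm)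
  have hGb : ∀ U, |G U| ≤ C1 * 1 * CΦ + C2 * 1 * CP ^ 2 := by
    intro U
    rw [abs_of_nonneg (hG0 U)]
    by_cases hS : U ∈ Sin
    · obtain ⟨hUT, -, -, -⟩ := hS
      obtain ⟨u, v, hv, rfl⟩ := hUT
      refine (hpt u v hv).trans ?_
      have hPa2 : Pa u ^ 2 ≤ CP ^ 2 := by rw [← sq_abs]; exact pow_le_pow_left₀ (abs_nonneg _) (hCP u) 2
      exact add_le_add (mul_le_mul (mul_le_mul_of_nonneg_left (hgf1_1 v) hC1nn) (hSΦb v u) (hSΦ0 v u) (mul_nonneg hC1nn zero_le_one))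
        (mul_le_mul (mul_le_mul_of_nonneg_left (hgf_1 v) hC2nn) hPa2 (sq_nonneg _) (mul_nonneg hC2nn zero_le_one))
    · rw [hG]; dsimp only
      rw [Set.indicator_of_notMem hS, zero_mul]; positivity
  have hGout : ∀ U, U ∉ orthoTubeSet L → G U = 0 := fun U hU => by
    rw [hG]; dsimp only
    rw [Set.indicator_of_notMem (fun h => hU h.1), zero_mul]
  -- disintegrate and integrate the pointwise bound
  have hdis := integral_configMeasure_orthoTube L hGm ⟨_, hGb⟩ hGout
  have hle : Measurable (linkEmbed L) := measurable_linkEmbed L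
  have hindm : Measurable fun v : Edge 3 L → Fin 3 → ℝ => ({v : Edge 3 L → Fin 3 → ℝ | ‖linkEmbed L v‖ ≤ Rin} : Set _).indicator (fun _ => (1 : ℝ)) v :=
    measurable_const.indicator (measurableSet_le hle.norm measurable_const)
  have hexpq : Measurable fun v : Edge 3 L → Fin 3 → ℝ => Real.exp (-(q β (linkEmbed L v))) := (((hqm β).comp hle).neg).exp
  have hexpg : Measurable fun v : Edge 3 L → Fin 3 → ℝ => Real.exp (-(‖(gaugeModes L).starProjection (linkEmbed L v)‖ ^ 2 / powScale 1 β ^ 2)) :=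
    (((((gaugeModes L).starProjection.continuous.measurable.comp hle).norm.pow_const 2).div_const _).neg).exp
  have hgf1m : Measurable gf1 := by rw [hgf1]; exact hindm.mul (hexpq.mul hexpg)
  have hgfm : Measurable gf := by rw [hgf]; exact hindm.mul ((hexpq.pow_const 2).mul hexpg)
  have hgf1b : ∀ v, |gf1 v| ≤ 1 := fun v => by rw [abs_of_nonneg (hgf1_0 v)]; exact hgf1_1 v
  have hgfb : ∀ v, |gf v| ≤ 1 := fun v => by rw [abs_of_nonneg (hgf0 v)]; exact hgf_1 v
  have hIPa : Integrable (fun u => Pa u ^ 2) (configMeasure SU2 1) :=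
    integrable_of_measurable_abs_le _ (hPam.pow_const 2) (C := CP ^ 2) fun u => by rw [abs_pow]; exact pow_le_pow_left₀ (abs_nonneg _) (hCP u) 2
  have hSΦm : Measurable (Function.uncurry SΦ) := by
    have h1 : Measurable fun p : (Edge 3 L → Fin 3 → ℝ) × GaugeConfig 3 1 SU2 => Wout.indicator (fun _ => (1 : ℝ)) p.2 :=
      (measurable_const.indicator hWout).comp measurable_snd
    have h2 : Measurable fun p : (Edge 3 L → Fin 3 → ℝ) × GaugeConfig 3 1 SU2 => Φ p.2 p.1 := hΦm.comp (measurable_snd.prodMk measurable_fst)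
    have e : Function.uncurry SΦ = fun p => Wout.indicator (fun _ => (1 : ℝ)) p.2 * Φ p.2 p.1 := by funext p; rfl
    rw [e]; exact h1.mul h2
  have hISΦ : ∀ v, Integrable (SΦ v) (configMeasure SU2 1) := fun v =>
    integrable_of_measurable_abs_le _ (hSΦm.comp (measurable_const.prodMk measurable_id)) (C := CΦ) fun u => by
      rw [abs_of_nonneg (hSΦ0 v u)]; exact hSΦb v u
  have hinner : ∀ v ∈ capBalancedSet L, ∫ u, G (orthoTube L u v) ∂configMeasure SU2 1 ≤
      C1 * gf1 v * ∫ u, SΦ v u ∂configMeasure SU2 1 + C2 * gf v * ∫ u, Pa u ^ 2 ∂configMeasure SU2 1 := by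
    intro v hv
    have hmaj : Integrable (fun u => C1 * gf1 v * SΦ v u + C2 * gf v * Pa u ^ 2) (configMeasure SU2 1) := ((hISΦ v).const_mul _).add (hIPa.const_mul _)
    have h := integral_mono_of_nonneg (ae_of_all _ fun u => hG0 _) hmaj (ae_of_all _ fun u => hpt u v hv)
    have k1 : Integrable (fun u => C1 * gf1 v * SΦ v u) (configMeasure SU2 1) := (hISΦ v).const_mul _
    have k2 : Integrable (fun u => C2 * gf v * Pa u ^ 2) (configMeasure SU2 1) := hIPa.const_mul _
    have e : ∫ u, (C1 * gf1 v * SΦ v u + C2 * gf v * Pa u ^ 2) ∂configMeasure SU2 1 =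
        C1 * gf1 v * ∫ u, SΦ v u ∂configMeasure SU2 1 + C2 * gf v * ∫ u, Pa u ^ 2 ∂configMeasure SU2 1 := by
      rw [integral_add k1 k2, integral_const_mul, integral_const_mul]
    rw [e] at h
    exact h
  have hae : ∀ᵐ v ∂orthoTransverse L, v ∈ capBalancedSet L := by
    rw [ae_iff]
    exact orthoTransverse_compl_capBalancedSet L
  -- the outer integrand `v ↦ gf1 v * ∫ SΦ v` is measurable and bounded
  have hJm : Measurable fun v => ∫ u, SΦ v u ∂configMeasure SU2 1 := by
    have h := (hSΦm.stronglyMeasurable.integral_prod_right' (ν := configMeasure SU2 1)).measurable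
    simpa only [Function.uncurry] using h
  have hJb : ∀ v, |∫ u, SΦ v u ∂configMeasure SU2 1| ≤ CΦ := fun v => by
    rw [abs_of_nonneg (integral_nonneg fun u => hSΦ0 v u)]
    calc ∫ u, SΦ v u ∂configMeasure SU2 1 ≤ ∫ _u, CΦ ∂configMeasure SU2 1 := integral_mono (hISΦ v) (integrable_const _) fun u => hSΦb v u
      _ = CΦ := by rw [integral_const, smul_eq_mul, probReal_univ, one_mul]
  have hI1 : Integrable (fun v => C1 * gf1 v * ∫ u, SΦ v u ∂configMeasure SU2 1) (orthoTransverse L) := by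
    refine integrable_of_measurable_abs_le _ ((hgf1m.const_mul C1).mul hJm) (C := C1 * 1 * CΦ) fun v => ?_
    rw [abs_mul, abs_mul, abs_of_nonneg hC1nn]
    exact mul_le_mul (mul_le_mul_of_nonneg_left (hgf1b v) hC1nn) (hJb v) (abs_nonneg _) (mul_nonneg hC1nn zero_le_one)
  have hI2 : Integrable (fun v => C2 * gf v * ∫ u, Pa u ^ 2 ∂configMeasure SU2 1) (orthoTransverse L) :=
    ((integrable_of_measurable_abs_le _ hgfm hgfb).const_mul C2).mul_const _
  rw [hdis]
  calc ∫ v, ∫ u, G (orthoTube L u v) ∂configMeasure SU2 1 ∂orthoTransverse L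
      ≤ ∫ v, (C1 * gf1 v * ∫ u, SΦ v u ∂configMeasure SU2 1 + C2 * gf v * ∫ u, Pa u ^ 2 ∂configMeasure SU2 1) ∂orthoTransverse L :=
        integral_mono_of_nonneg (ae_of_all _ fun v => integral_nonneg fun u => hG0 _) (hI1.add hI2) (hae.mono fun v hv => hinner v hv)
    _ = C1 * ∫ v, gf1 v * ∫ u, SΦ v u ∂configMeasure SU2 1 ∂orthoTransverse L + C2 * (∫ v, gf v ∂orthoTransverse L) * ∫ u, Pa u ^ 2 ∂configMeasure SU2 1 := by
        rw [integral_add hI1 hI2, integral_mul_const, integral_const_mul]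
        have e : (fun v => C1 * gf1 v * ∫ u, SΦ v u ∂configMeasure SU2 1) = fun v => C1 * (gf1 v * ∫ u, SΦ v u ∂configMeasure SU2 1) := by funext v; ring
        rw [e, integral_const_mul]

end Summit.QuantumFields.YangMills.Theorems.FemtoTransferGap.TwoLattice.ConstTube

end
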